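import Summits.RiemannHypothesis.RiemannHypothesis.Theorems.WeilWindowFlowGronwallLeakageStrictAntiForm
import Summits.RiemannHypothesis.RiemannHypothesis.Theorems.WeilWindowFlowGronwallLeakageStrictAntiTranslates
import Summits.RiemannHypothesis.RiemannHypothesis.Theorems.GronwallLeakage.Negative.Structure
import Literature.NumberTheory.LFunctions.WeilSemilocalCompactnessProofs
import HarnessLib

/-!
# The window bottom is STRICTLY decreasing (crux stmt-RiemannHypothesis-1037 `GronwallLeakage`,
route WeilWindowFlow; line `Sketch`, lead c6) — unconditional

`ε = weilGroundEnergy` (bottom of Weil's quadratic form `Re Q` on the `L²`-unit sphere of test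
functions supported in `[-a, a]`) is strictly decreasing on `(0, ∞)`:
`weilGroundEnergy_strictAntiOn : StrictAntiOn weilGroundEnergy (Ioi 0)`.
Bombieri 2000 (Thm 5) proves `ε` continuous and non-increasing; strictness is the new point, and it is
exactly what the Grönwall-flow picture of the crux needs past a conjugate point.

## Proof (translation invariance + compactness, operator-free)
Suppose `0 < a < A` and `ε A = ε a`. The shifted form `s_A(φ) = Re Q(φ) - ε(A)‖φ‖₂²` is a
non-negative quadratic form on the test functions of the window `[-A, A]` (Cauchy–Schwarz,
`shiftedForm_add_le`). Let `gₙ → u` be a normalised minimising sequence at the SMALLER window `a` with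
ground state `u` (exists by the compactness theorem `ConnesConsaniMoscovici2025_thm_3_6_holds`); then
`s_A(gₙ) = Re Q(gₙ) - ε(a) → 0`. The `m` translates `gₙ(· + j d)`, `d = (A - a)/(m + 1)`, stay inside
`[-A, A]` and have the same `s_A`-value (translation invariance of `Q`), so their real span `Wₙ` has
`s_A(w) ≤ (m‖c‖)² s_A(gₙ)` (toolkit I, `shiftedForm_span_translates_bound`), while
`‖w‖₂² ≥ κ‖c‖²` uniformly for large `n` because the translates of the compactly supported `u ≠ 0` are
linearly independent (toolkit II, `translates_uniformly_independent`: Mellin transform, identity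
theorem). Hence for large `n`, `Wₙ` is an `m`-dimensional space of window-`A` test functions with
`Re Q(w) ≤ (ε(A) + 1)‖w‖₂²` (§1). Since `m` is arbitrary, a recursion produces an infinite
`L²`-ORTHONORMAL sequence of window-`A` unit test functions with `Re Q ≤ ε(A) + 1` (§2), which has no
`L²`-convergent subsequence (`‖wᵢ - w_k‖₂ = √2`) — contradicting the compactness theorem (§3).

## Consequences (§4; flow corollaries in `…StrictAntiFlow.lean`)
* `weilGroundEnergy_lt_of_lt`, `weilGroundEnergy_strictAntiOn`;
* `weilGroundEnergy_pos_of_weilPositivityOn_of_lt` — a certified rung `WeilPositivityOn A` gives STRICT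
  positivity `0 < ε a` for every `0 < a < A` (the flow consequences — leakage law below a rung, the sharp
  conjugate point under `¬RH` — are in `WeilWindowFlowGronwallLeakageStrictAntiFlow.lean`);
* `weilGroundEnergy_neg_of_eq_zero_of_lt` — the bottom vanishes at most once: past a conjugate point
  `a⋆` Weil positivity FAILS AT EVERY WINDOW (`not_weilPositivityOn_of_conjugatePoint_lt`).

Axioms ⊆ {propext, Classical.choice, Quot.sound}.
-/

-- `Summit.RiemannHypothesis.RiemannHypothesis.…` repeats a namespace component by design (D-0017 layout).
set_option linter.dupNamespace false

noncomputable section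

open MeasureTheory Set Filter Complex
open scoped Topology ComplexConjugate BigOperators ENNReal

namespace Summit.RiemannHypothesis.RiemannHypothesis.Theorems.WeilWindowFlowGronwallLeakage

open Literature.NumberTheory.LFunctions
open Literature.NumberTheory.LFunctions.ConnesVanSuijlekom
open Summit.RiemannHypothesis.Cruxes.GronwallLeakage.Negative

/-! ## §1 Almost-null spans of translates -/

/-- **Almost-null spans of translates.** If `0 < a < A` and `ε A = ε a`, then for every `m` there are
`m` test functions `F_j` supported in `[-A, A]` (equally spaced translates of a near-minimiser of the
window `a`) and `κ > 0` with, for every real `c`,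
`κ ‖c‖² ≤ ‖Σ_j c_j F_j‖₂²` and `Re Q(Σ_j c_j F_j) - ε(A) ‖Σ_j c_j F_j‖₂² ≤ ‖Σ_j c_j F_j‖₂²`. [folklore] -/
theorem exists_almostNull_family {a A : ℝ} (ha : 0 < a) (haA : a < A)
    (hE : weilGroundEnergy A = weilGroundEnergy a) (m : ℕ) :
    ∃ F : Fin m → ℝ → ℂ, (∀ j, IsWeilTest (F j)) ∧ (∀ j, tsupport (F j) ⊆ Icc (-A) A) ∧
      ∃ κ : ℝ, 0 < κ ∧
        (∀ c : Fin m → ℝ, κ * ‖c‖ ^ 2 ≤ ∫ t, ‖∑ j, (c j : ℂ) * F j t‖ ^ 2) ∧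
        (∀ c : Fin m → ℝ, (weilQuadratic fun t ↦ ∑ j, (c j : ℂ) * F j t).re -
            weilGroundEnergy A * ∫ t, ‖∑ j, (c j : ℂ) * F j t‖ ^ 2 ≤
          ∫ t, ‖∑ j, (c j : ℂ) * F j t‖ ^ 2) := by
  -- ground state and minimising sequence at the window `a`
  obtain ⟨u, hu⟩ := ConnesConsaniMoscovici2025_thm_3_6_holds.exists_isWeilGroundState ha
  obtain ⟨g, hg, hQ, hL2⟩ := hu.2
  -- step and shifts
  set d : ℝ := (A - a) / ((m : ℝ) + 1) with hd
  have hd0 : 0 < d := div_pos (by linarith) (by positivity)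
  have hmd : (m : ℝ) * d ≤ A - a := by
    rw [hd, mul_div_assoc', div_le_iff₀ (by positivity)]
    nlinarith
  -- uniform independence of the translates (toolkit II)
  obtain ⟨κ, hκ, hev⟩ := translates_uniformly_independent a u g m d hu
    (fun n ↦ isWeilTest_memLp (hg n).1) hL2 hd0.ne'
  -- the shifted form values of `gₙ` tend to `0`
  have hS : Tendsto (fun n ↦ (weilQuadratic (g n)).re - weilGroundEnergy A * ∫ t, ‖g n t‖ ^ 2)
      atTop (𝓝 0) := by
    have h1 : (fun n ↦ (weilQuadratic (g n)).re - weilGroundEnergy A * ∫ t, ‖g n t‖ ^ 2) =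
        fun n ↦ (weilQuadratic (g n)).re - weilGroundEnergy a := by
      funext n
      rw [(hg n).2.2, mul_one, hE]
    rw [h1, show (0 : ℝ) = weilGroundEnergy a - weilGroundEnergy a by ring]
    exact hQ.sub_const _
  have hη : 0 < κ / ((m : ℝ) + 1) ^ 2 := by positivity
  have hev2 : ∀ᶠ n in atTop,
      (weilQuadratic (g n)).re - weilGroundEnergy A * ∫ t, ‖g n t‖ ^ 2 < κ / ((m : ℝ) + 1) ^ 2 :=
    (tendsto_order.1 hS).2 _ hη
  obtain ⟨n, hn1, hn2⟩ := (hev.and hev2).exists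
  have hSn0 : 0 ≤ (weilQuadratic (g n)).re - weilGroundEnergy A * ∫ t, ‖g n t‖ ^ 2 := by
    have := weilGroundEnergy_mul_le_re (hg n).1
      ((hg n).2.1.trans (Icc_subset_Icc (by linarith) haA.le))
    linarith
  have hjd : ∀ j : Fin m, ((j : ℕ) : ℝ) * d ≤ A - a := by
    intro j
    have hj : ((j : ℕ) : ℝ) ≤ m := by exact_mod_cast j.2.le
    exact (mul_le_mul_of_nonneg_right hj hd0.le).trans hmd
  -- the family of translates of `gₙ`
  refine ⟨fun j t ↦ g n (t + (j : ℕ) * d), fun j ↦ isWeilTest_translate (hg n).1 _,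
    fun j ↦ tsupport_translate_subset_window haA.le (hg n).2.1 (by positivity) (hjd j),
    κ, hκ, hn1, fun c ↦ ?_⟩
  have hbound := shiftedForm_span_translates_bound m (g n) a A d (hg n).1 (hg n).2.1 haA.le hd0.le
    hmd c
  have hr : ((m : ℝ) / ((m : ℝ) + 1)) ^ 2 ≤ 1 := by
    have h01 : 0 ≤ (m : ℝ) / ((m : ℝ) + 1) := by positivity
    have h1 : (m : ℝ) / ((m : ℝ) + 1) ≤ 1 := by
      rw [div_le_one (by positivity)]
      linarith
    exact pow_le_one₀ h01 h1
  calc _ ≤ ((m : ℝ) * ‖c‖) ^ 2 *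
        ((weilQuadratic (g n)).re - weilGroundEnergy A * ∫ t, ‖g n t‖ ^ 2) := hbound
    _ ≤ ((m : ℝ) * ‖c‖) ^ 2 * (κ / ((m : ℝ) + 1) ^ 2) :=
        mul_le_mul_of_nonneg_left hn2.le (by positivity)
    _ = κ * ‖c‖ ^ 2 * ((m : ℝ) / ((m : ℝ) + 1)) ^ 2 := by
        rw [div_pow]
        field_simp
    _ ≤ κ * ‖c‖ ^ 2 * 1 := by gcongr
    _ = κ * ‖c‖ ^ 2 := mul_one _
    _ ≤ _ := hn1 c

/-! ## §2 One more orthonormal almost-null unit vector -/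

/-- **Orthogonal extension.** If `0 < a < A` and `ε A = ε a`, then for every finite list `l` of
functions there is a unit test function `w` of the window `[-A, A]` with `Re Q(w) ≤ ε(A) + 1` which is
`L²`-orthogonal (real part of the pairing) to every test function in `l`: take the almost-null family of
size `|l| + 1` (§1); the `|l|` linear orthogonality conditions have a non-zero solution `c` in `ℝ^{|l|+1}`
(`LinearMap.ker_ne_bot_of_finrank_lt`); normalise `Σ_j c_j F_j`. [folklore] -/
theorem exists_orthogonal_unit {a A : ℝ} (ha : 0 < a) (haA : a < A)
    (hE : weilGroundEnergy A = weilGroundEnergy a) (l : List (ℝ → ℂ)) :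
    ∃ w : ℝ → ℂ, IsWeilTest w ∧ tsupport w ⊆ Icc (-A) A ∧ ∫ t, ‖w t‖ ^ 2 = 1 ∧
      (weilQuadratic w).re ≤ weilGroundEnergy A + 1 ∧
      ∀ v ∈ l, IsWeilTest v → (∫ t, v t * conj (w t)).re = 0 := by
  obtain ⟨F, hF, hFs, κ, hκ, hlow, hform⟩ := exists_almostNull_family ha haA hE (l.length + 1)
  -- the matrix of pairings with the list, and a non-zero kernel vector
  set M : Matrix (Fin l.length) (Fin (l.length + 1)) ℝ :=
    fun i j ↦ (∫ t, l.get i t * conj (F j t)).re with hM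
  have hker : LinearMap.ker (Matrix.mulVecLin M) ≠ ⊥ :=
    LinearMap.ker_ne_bot_of_finrank_lt (by simp)
  obtain ⟨c, hc, hc0⟩ := Submodule.exists_mem_ne_zero_of_ne_bot hker
  rw [LinearMap.mem_ker, Matrix.mulVecLin_apply] at hc
  -- the combination `wc = Σ c_j F_j`
  set wc : ℝ → ℂ := fun t ↦ ∑ j, (c j : ℂ) * F j t with hwc
  have hwct : IsWeilTest wc := isWeilTest_sum_real_mul _ hF c
  have hwcs : tsupport wc ⊆ Icc (-A) A := tsupport_sum_real_mul_subset _ hFs c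
  set N : ℝ := ∫ t, ‖wc t‖ ^ 2 with hN
  have hNpos : 0 < N := by
    have h1 := hlow c
    have h2 : 0 < ‖c‖ := norm_pos_iff.2 hc0
    have h3 : 0 < κ * ‖c‖ ^ 2 := by positivity
    exact h3.trans_le h1
  -- `wc` is orthogonal to the test functions of the list
  have horth : ∀ i : Fin l.length, IsWeilTest (l.get i) →
      (∫ t, l.get i t * conj (wc t)).re = 0 := by
    intro i hv
    have hci := congr_fun hc i
    simp only [Matrix.mulVec, dotProduct, Pi.zero_apply] at hci
    have hI : ∀ j ∈ (Finset.univ : Finset (Fin (l.length + 1))),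
        Integrable fun t ↦ (c j : ℂ) * (l.get i t * conj (F j t)) :=
      fun j _ ↦ (integrable_mul_conj hv (hF j)).const_mul _
    have e : (∫ t, l.get i t * conj (wc t)) = ∑ j, (c j : ℂ) * ∫ t, l.get i t * conj (F j t) := by
      calc (∫ t, l.get i t * conj (wc t))
          = ∫ t, ∑ j, (c j : ℂ) * (l.get i t * conj (F j t)) := by
            congr 1
            funext t
            simp only [hwc, map_sum, map_mul, Complex.conj_ofReal, Finset.mul_sum]
            exact Finset.sum_congr rfl fun j _ ↦ by ring
        _ = ∑ j, ∫ t, (c j : ℂ) * (l.get i t * conj (F j t)) := integral_finsetSum _ hI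
        _ = ∑ j, (c j : ℂ) * ∫ t, l.get i t * conj (F j t) :=
            Finset.sum_congr rfl fun j _ ↦ integral_const_mul _ _
    rw [e, Complex.re_sum]
    simp only [Complex.re_ofReal_mul]
    rw [← hci]
    exact Finset.sum_congr rfl fun j _ ↦ by rw [hM, mul_comm]
  -- normalise
  set r : ℝ := (Real.sqrt N)⁻¹ with hr
  have hr2 : r ^ 2 * N = 1 := by
    rw [hr, inv_pow, Real.sq_sqrt hNpos.le, inv_mul_cancel₀ hNpos.ne']
  have hnorm1 : ∫ t, ‖(fun x ↦ (r : ℂ) * wc x) t‖ ^ 2 = 1 := by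
    rw [integral_norm_sq_real_mul, hr2.symm.trans rfl]
  refine ⟨fun t ↦ (r : ℂ) * wc t, hwct.const_mul r, tsupport_mul_subset_right.trans hwcs, hnorm1,
    ?_, ?_⟩
  · have h1 := shiftedForm_real_mul A r wc
    have h2 := hform c
    rw [hnorm1, mul_one] at h1
    have h3 : r ^ 2 * ((weilQuadratic wc).re - weilGroundEnergy A * N) ≤ r ^ 2 * N :=
      mul_le_mul_of_nonneg_left h2 (sq_nonneg r)
    linarith
  · intro v hv hvt
    obtain ⟨i, rfl⟩ := List.get_of_mem hv
    have h0 := horth i hvt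
    have e : (∫ t, l.get i t * conj ((r : ℂ) * wc t)) = (r : ℂ) * ∫ t, l.get i t * conj (wc t) := by
      rw [← integral_const_mul]
      congr 1
      funext t
      simp only [map_mul, Complex.conj_ofReal]
      ring
    rw [e, Complex.re_ofReal_mul, h0, mul_zero]

/-! ## §3 The contradiction with compactness: `ε A ≠ ε a` -/

/-- **`ε A ≠ ε a` for `0 < a < A`.** Otherwise §2 produces, by recursion, an `L²`-orthonormal sequence
of unit test functions of the window `[-A, A]` with `Re Q ≤ ε(A) + 1`; it is `√2`-separated in `L²`,
so it has no `L²`-convergent subsequence, contradicting the compactness theorem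
`ConnesConsaniMoscovici2025_thm_3_6_holds` (Connes–Consani–Moscovici 2025 Thm 3.6 / Bombieri 2000
Thm 3). [folklore] -/
theorem weilGroundEnergy_ne_of_lt {a A : ℝ} (ha : 0 < a) (haA : a < A) :
    weilGroundEnergy A ≠ weilGroundEnergy a := by
  intro hE
  have hA : 0 < A := ha.trans haA
  -- the step (§2) and the recursion
  choose next hnext using exists_orthogonal_unit ha haA hE
  let st : ℕ → List (ℝ → ℂ) := fun k ↦ Nat.rec [] (fun _ l ↦ l ++ [next l]) k
  have hst : ∀ k, st (k + 1) = st k ++ [next (st k)] := fun k ↦ rfl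
  set w : ℕ → ℝ → ℂ := fun k ↦ next (st k) with hw
  have hmem : ∀ i k : ℕ, i < k → w i ∈ st k := by
    intro i k hik
    induction k with
    | zero => exact absurd hik (Nat.not_lt_zero _)
    | succ k ih =>
      rw [hst]
      rcases Nat.lt_succ_iff_lt_or_eq.1 hik with h | h
      · exact List.mem_append_left _ (ih h)
      · subst h
        exact List.mem_append_right _ (List.mem_singleton_self _)
  have htest : ∀ k, IsWeilTest (w k) := fun k ↦ (hnext (st k)).1
  have hsupp : ∀ k, tsupport (w k) ⊆ Icc (-A) A := fun k ↦ (hnext (st k)).2.1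
  have hnorm : ∀ k, ∫ t, ‖w k t‖ ^ 2 = 1 := fun k ↦ (hnext (st k)).2.2.1
  have hQle : ∀ k, (weilQuadratic (w k)).re ≤ weilGroundEnergy A + 1 :=
    fun k ↦ (hnext (st k)).2.2.2.1
  have horth : ∀ i k : ℕ, i < k → (∫ t, w i t * conj (w k t)).re = 0 :=
    fun i k hik ↦ (hnext (st k)).2.2.2.2 (w i) (hmem i k hik) (htest i)
  -- compactness
  obtain ⟨u', hu', φ, hφ, hconv⟩ := ConnesConsaniMoscovici2025_thm_3_6_holds A hA w
    (fun n ↦ ⟨htest n, hsupp n, hnorm n⟩)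
    ⟨weilGroundEnergy A + 1, by rintro _ ⟨n, rfl⟩; exact hQle n⟩
  -- the sequence is `√2`-separated in `L²`
  have hfar : ∀ i k : ℕ, i < k → ∫ t, ‖w i t - w k t‖ ^ 2 = 2 := by
    intro i k hik
    have h := integral_norm_sq_add_real_mul (htest i) (htest k) (-1)
    have e : (w i + fun x ↦ ((-1 : ℝ) : ℂ) * w k x) = fun t ↦ w i t - w k t := by
      funext t
      simp only [Pi.add_apply]
      push_cast
      ring
    rw [e] at h
    rw [h, hnorm i, hnorm k, horth i k hik]
    norm_num
  -- but a subsequence converges in `L²`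
  have hev : ∀ᶠ n in atTop, ∫ t, ‖w (φ n) t - u' t‖ ^ 2 < 1 / 4 :=
    (tendsto_order.1 hconv).2 _ (by norm_num)
  obtain ⟨N₀, hN₀⟩ := hev.exists_forall_of_atTop
  have h1 := hN₀ N₀ le_rfl
  have h2 := hN₀ (N₀ + 1) (Nat.le_succ _)
  have hlt : φ N₀ < φ (N₀ + 1) := hφ (Nat.lt_succ_self _)
  have hmw : ∀ n, MemLp (fun t ↦ w (φ n) t - u' t) 2 volume :=
    fun n ↦ (isWeilTest_memLp (htest _)).sub hu'
  have hmink := sqrt_integral_norm_sq_sub_le (hmw N₀) (hmw (N₀ + 1))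
  simp only [sub_sub_sub_cancel_right] at hmink
  rw [hfar _ _ hlt] at hmink
  have hhalf : Real.sqrt (1 / 4) = 1 / 2 := by
    rw [show (1 / 4 : ℝ) = (1 / 2) ^ 2 by norm_num, Real.sqrt_sq (by norm_num)]
  have hs1 : Real.sqrt (∫ t, ‖w (φ N₀) t - u' t‖ ^ 2) < 1 / 2 := by
    rw [← hhalf]
    exact Real.sqrt_lt_sqrt (integral_nonneg fun _ ↦ by positivity) h1
  have hs2 : Real.sqrt (∫ t, ‖w (φ (N₀ + 1)) t - u' t‖ ^ 2) < 1 / 2 := by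
    rw [← hhalf]
    exact Real.sqrt_lt_sqrt (integral_nonneg fun _ ↦ by positivity) h2
  have hsqrt2 : (1 : ℝ) < Real.sqrt 2 := by
    rw [show (1 : ℝ) = Real.sqrt 1 by simp]
    exact Real.sqrt_lt_sqrt zero_le_one one_lt_two
  linarith

/-! ## §4 Strict antitonicity and first consequences -/

/-- **The window bottom is strictly decreasing**: `0 < a < A → ε A < ε a`. [folklore] -/
theorem weilGroundEnergy_lt_of_lt {a A : ℝ} (ha : 0 < a) (haA : a < A) :
    weilGroundEnergy A < weilGroundEnergy a :=
  lt_of_le_of_ne (weilGroundEnergy_antitone_of_pos' ha haA.le) (weilGroundEnergy_ne_of_lt ha haA)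

/-- **Headline (registered sub-goal of crux stmt-RiemannHypothesis-1037).** `ε = weilGroundEnergy` is
STRICTLY antitone on `(0, ∞)` — unconditional (Bombieri 2000 Thm 5: non-increasing; strictness by
translation invariance + compactness). [folklore] -/
theorem weilGroundEnergy_strictAntiOn : StrictAntiOn weilGroundEnergy (Ioi 0) :=
  fun _ ha _ _ hab ↦ weilGroundEnergy_lt_of_lt ha hab

/-- **A certified rung gives strict positivity below it**: `WeilPositivityOn A` and `0 < a < A` give
`0 < ε a` (`ε A ≥ 0` by `weilGroundEnergy_nonneg_iff_holds`, then strictness). [folklore] -/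
theorem weilGroundEnergy_pos_of_weilPositivityOn_of_lt {a A : ℝ} (hA : WeilPositivityOn A)
    (ha : 0 < a) (haA : a < A) : 0 < weilGroundEnergy a :=
  lt_of_le_of_lt ((weilGroundEnergy_nonneg_iff_holds (ha.trans haA)).2 hA)
    (weilGroundEnergy_lt_of_lt ha haA)

/-- **The bottom vanishes at most once**: `ε a = 0` at `a > 0` forces `ε A < 0` for every `A > a`.
[folklore] -/
theorem weilGroundEnergy_neg_of_eq_zero_of_lt {a A : ℝ} (ha : 0 < a) (h0 : weilGroundEnergy a = 0)
    (haA : a < A) : weilGroundEnergy A < 0 :=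
  h0 ▸ weilGroundEnergy_lt_of_lt ha haA

/-- Uniqueness of the zero: two positive windows with `ε = 0` coincide. [folklore] -/
theorem eq_of_weilGroundEnergy_eq_zero {a b : ℝ} (ha : 0 < a) (hb : 0 < b)
    (ha0 : weilGroundEnergy a = 0) (hb0 : weilGroundEnergy b = 0) : a = b := by
  by_contra hne
  rcases lt_or_gt_of_ne hne with h | h
  · exact (weilGroundEnergy_neg_of_eq_zero_of_lt ha ha0 h).ne hb0
  · exact (weilGroundEnergy_neg_of_eq_zero_of_lt hb hb0 h).ne ha0

/-- **Past a conjugate point Weil positivity fails at every window**: `ε a⋆ = 0`, `0 < a⋆ < A` give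
`¬ WeilPositivityOn A`. [folklore] -/
theorem not_weilPositivityOn_of_conjugatePoint_lt {aStar A : ℝ} (haStar : 0 < aStar)
    (h0 : weilGroundEnergy aStar = 0) (hA : aStar < A) : ¬ WeilPositivityOn A := fun hpos ↦
  (weilGroundEnergy_neg_of_eq_zero_of_lt haStar h0 hA).not_ge
    ((weilGroundEnergy_nonneg_iff_holds (haStar.trans hA)).2 hpos)

end Summit.RiemannHypothesis.RiemannHypothesis.Theorems.WeilWindowFlowGronwallLeakage

end
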